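import Mathlib
import HarnessLib
import Literature.MathematicalPhysics.StatisticalMechanics.TorusFRDFinalMultipliers
import Literature.MathematicalPhysics.StatisticalMechanics.CovarianceComparisonShellRatio

/-!
# Counting the dyadic momentum shells of the torus `(ℤ/L^N)^d` and the Hilbert–Schmidt sum of the
# shell-wise relative change of the finite-range decomposition ([Buc16] (4.36)–(4.37))

The volume-uniform form of [ABKM19] Lemma 8.4 prices the change of the step measure in the tuning
parameter by the Hilbert–Schmidt size `(Σ_{κ≠0} ρ(κ)²)^{1/2}` of the MODE-WISE relative change `ρ(κ)` of
the multipliers (`FluctuationKernelComparisonTrace`).  On shell `𝔸_j` (dual momenta `|p| ∼ L^{−j}`)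
the relative change of the scale-`k` kernel is `≤ E · K/L^{(k−j)(ñ−n)}` (`TorusFRDKernelComparisonShell`),
and shell `j` of the torus `(ℤ/L^N)^d` holds at most `3^d L^{(N−j)d}` modes.  With the regularity gap
`2(ñ−n) ≥ d+1` of the decomposition the sum over shells is geometric ([Buc16], last display of the proof
of Thm 4.5: "where we used `2ñ − 2n > d` in the last step"):

* `card_filter_supNorm_le_le` — `#{κ : |κ̃|_∞ ≤ R} ≤ (2R+1)^d`;
* `supNorm_le_pow_of_inShell` — `κ ≠ 0 ∈ 𝔸_j`, `j ≥ 1`, `M = L^N` ⇒ `|κ̃|_∞ ≤ L^{N−j}`;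
* **`card_filter_inShell_le`** — `#{κ ≠ 0 : κ ∈ 𝔸_j} ≤ 3^d · L^{(N−j)d}` (`L ≥ 5`, `M = L^N`);
* **`sum_sq_le_sum_shells`** — `Σ_κ ρ(κ)² ≤ Σ_{j ≤ N} 3^d L^{(N−j)d} g(j)²` whenever `ρ(0) = 0` and every
  `κ ≠ 0` lies in a shell `j` with `|ρ(κ)| ≤ g(j)`;
* `pow_div_shell_sq_le`, **`sum_shells_geom_le`** — `Σ_{j ≤ N} L^{(N−j)d}/L^{2(k−j)(ñ−n)} ≤ 3 L^{(N−k)d}`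
  for `L ≥ 2`, `d ≥ 1`, `d + 1 ≤ 2(ñ−n)`;
* **`sum_sq_le_of_shellRatio`** — the packaged Hilbert–Schmidt bound
  `Σ_κ ρ(κ)² ≤ 3^{d+1} (E K)² L^{(N−k)d}` for `|ρ(κ)| ≤ E · K/L^{(k−j)(ñ−n)}` on shell `j`.

Everything is proved; no named fact.

## References
* S. Buchholz, J. Funct. Anal. 275 (2018), Thm 4.5, (4.36)–(4.37) [Buchholz2016].
* S. Adams, S. Buchholz, R. Kotecký, S. Müller, arXiv:1910.13564, Lemma 8.4, Remark 7.4
  [AdamsBuchholzKoteckyMuller2019].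
-/

noncomputable section

namespace Literature.MathematicalPhysics.StatisticalMechanics.GradientRG

open scoped BigOperators Classical
open Real Finset
open Literature.MathematicalPhysics.StatisticalMechanics.GradientFRD
  (InShell supNorm momNorm exists_inShell inShell_le supNorm_le_momNorm natAbs_valMinAbs_le_supNorm)

variable {d M : ℕ} [NeZero M]

/-! ## Counting a sup-norm box -/

/-- The number of `κ ∈ (ℤ/M)^d` with `|κ̃|_∞ ≤ R` is at most `(2R+1)^d`.
[cite: Buchholz2016, App. A (A.15)] -/
theorem card_filter_supNorm_le_le (R : ℕ) :
    ((univ.filter fun κ : Fin d → ZMod M => supNorm κ ≤ R).card : ℕ) ≤ (2 * R + 1) ^ d := by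
  classical
  set S : Finset ℤ := Finset.Icc (-(R : ℤ)) R with hS
  have hcardS : S.card = 2 * R + 1 := by
    rw [hS, Int.card_Icc]
    have : (R : ℤ) + 1 - -(R : ℤ) = ((2 * R + 1 : ℕ) : ℤ) := by push_cast; ring
    rw [this, Int.toNat_natCast]
  set f : (Fin d → ZMod M) → (Fin d → ℤ) := fun κ i => (κ i).valMinAbs with hf
  have hmaps : Set.MapsTo f ↑(univ.filter fun κ : Fin d → ZMod M => supNorm κ ≤ R)
      ↑(Fintype.piFinset fun _ : Fin d => S) := by
    intro κ hκ
    rw [coe_filter, Set.mem_setOf_eq] at hκ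
    rw [mem_coe, Fintype.mem_piFinset]
    intro i
    rw [hS, mem_Icc]
    have h1 : ((κ i).valMinAbs).natAbs ≤ R := (natAbs_valMinAbs_le_supNorm κ i).trans hκ.2
    have h2 : (((κ i).valMinAbs).natAbs : ℤ) ≤ ((R : ℕ) : ℤ) := by exact_mod_cast h1
    rw [Int.natCast_natAbs] at h2
    simp only [hf]
    constructor <;> [linarith [neg_abs_le ((κ i).valMinAbs)]; linarith [le_abs_self ((κ i).valMinAbs)]]
  have hinj : Set.InjOn f ↑(univ.filter fun κ : Fin d → ZMod M => supNorm κ ≤ R) := by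
    intro κ _ κ' _ h
    funext i
    have := congrFun h i
    simp only [hf] at this
    exact ZMod.valMinAbs_inj.1 this
  calc ((univ.filter fun κ : Fin d → ZMod M => supNorm κ ≤ R).card : ℕ)
      ≤ (Fintype.piFinset fun _ : Fin d => S).card := card_le_card_of_injOn f hmaps hinj
    _ = S.card ^ d := Fintype.card_piFinset_const S d
    _ = (2 * R + 1) ^ d := by rw [hcardS]

/-! ## Shells lie in sup-norm boxes -/

/-- **A nonzero mode in shell `j ≥ 1` of the torus of side `M = L^N` has `|κ̃|_∞ ≤ L^{N−j}`**:
`(2π/M)|κ̃|_∞ ≤ |p(κ)| ≤ L^{−j}` and `M/(2π L^j) ≤ L^{N−j}` (`j ≤ N` by `inShell_le`).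
[cite: Buchholz2016, §2 (the annuli 𝔸_j)] -/
theorem supNorm_le_pow_of_inShell {L N : ℕ} (hL : 5 ≤ L) (hM : M = L ^ N) {j : ℕ} (hj1 : 1 ≤ j)
    {κ : Fin d → ZMod M} (hκ : κ ≠ 0) (hj : InShell L j κ) : supNorm κ ≤ L ^ (N - j) := by
  have hjN : j ≤ N := inShell_le hL hM hκ hj
  have hL1 : 1 ≤ L := by omega
  have hLr : (0 : ℝ) < L := by exact_mod_cast (show 0 < L by omega)
  have hMpos : (0 : ℝ) < M := by exact_mod_cast Nat.pos_of_ne_zero (NeZero.ne M)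
  have hmom : momNorm κ ≤ ((L : ℝ) ^ j)⁻¹ := GradientFRD.momNorm_le_of_inShell hL1 hj hj1 le_rfl
  have hsup : 2 * π / M * (supNorm κ : ℝ) ≤ ((L : ℝ) ^ j)⁻¹ := (supNorm_le_momNorm κ).trans hmom
  -- `|κ̃|_∞ ≤ M / (2π L^j) ≤ L^{N-j}`
  have hM' : (M : ℝ) = (L : ℝ) ^ N := by rw [hM]; push_cast; rfl
  have h1 : (supNorm κ : ℝ) ≤ (M : ℝ) / (2 * π * (L : ℝ) ^ j) := by
    rw [le_div_iff₀ (by positivity)]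
    have := mul_le_mul_of_nonneg_left hsup (show (0 : ℝ) ≤ M * (L : ℝ) ^ j by positivity)
    calc (supNorm κ : ℝ) * (2 * π * (L : ℝ) ^ j) = M * (L : ℝ) ^ j * (2 * π / M * (supNorm κ : ℝ)) := by
          field_simp
      _ ≤ M * (L : ℝ) ^ j * ((L : ℝ) ^ j)⁻¹ := this
      _ = M := by field_simp
  have h2 : (M : ℝ) / (2 * π * (L : ℝ) ^ j) ≤ (L : ℝ) ^ (N - j) := by
    rw [div_le_iff₀ (by positivity), hM', ← pow_sub_mul_pow (L : ℝ) hjN]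
    have hπ : (1 : ℝ) ≤ 2 * π := by linarith [Real.pi_gt_three]
    have h0 : (0 : ℝ) ≤ (L : ℝ) ^ (N - j) * (L : ℝ) ^ j := by positivity
    calc (L : ℝ) ^ (N - j) * (L : ℝ) ^ j = (L : ℝ) ^ (N - j) * (L : ℝ) ^ j * 1 := (mul_one _).symm
      _ ≤ (L : ℝ) ^ (N - j) * (L : ℝ) ^ j * (2 * π) := mul_le_mul_of_nonneg_left hπ h0
      _ = (L : ℝ) ^ (N - j) * (2 * π * (L : ℝ) ^ j) := by ring
  have h3 : (supNorm κ : ℝ) ≤ ((L ^ (N - j) : ℕ) : ℝ) := by push_cast; exact h1.trans h2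
  exact_mod_cast h3

/-- **Shell `j` of `(ℤ/L^N)^d` contains at most `3^d · L^{(N−j)d}` nonzero modes** (`L ≥ 5`).
[cite: Buchholz2016, Thm 4.5 (proof, (4.37))] -/
theorem card_filter_inShell_le {L N : ℕ} (hL : 5 ≤ L) (hM : M = L ^ N) (j : ℕ) :
    ((univ.filter fun κ : Fin d → ZMod M => κ ≠ 0 ∧ InShell L j κ).card : ℕ) ≤ 3 ^ d * L ^ ((N - j) * d) := by
  classical
  rcases Nat.eq_zero_or_pos j with hj0 | hjpos
  · -- `j = 0`: all of `(ℤ/M)^d`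
    subst hj0
    calc ((univ.filter fun κ : Fin d → ZMod M => κ ≠ 0 ∧ InShell L 0 κ).card : ℕ)
        ≤ (univ : Finset (Fin d → ZMod M)).card := card_filter_le _ _
      _ = M ^ d := by rw [card_univ, Fintype.card_fun, ZMod.card, Fintype.card_fin]
      _ = L ^ ((N - 0) * d) := by rw [hM, Nat.sub_zero, pow_mul]
      _ ≤ 3 ^ d * L ^ ((N - 0) * d) := Nat.le_mul_of_pos_left _ (by positivity)
  · -- `j ≥ 1`: inside the box `|κ̃|_∞ ≤ L^{N-j}`
    have hsub : (univ.filter fun κ : Fin d → ZMod M => κ ≠ 0 ∧ InShell L j κ) ⊆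
        univ.filter fun κ : Fin d → ZMod M => supNorm κ ≤ L ^ (N - j) := by
      intro κ hκ
      rw [mem_filter] at hκ ⊢
      exact ⟨mem_univ _, supNorm_le_pow_of_inShell hL hM hjpos hκ.2.1 hκ.2.2⟩
    calc ((univ.filter fun κ : Fin d → ZMod M => κ ≠ 0 ∧ InShell L j κ).card : ℕ)
        ≤ (univ.filter fun κ : Fin d → ZMod M => supNorm κ ≤ L ^ (N - j)).card := card_le_card hsub
      _ ≤ (2 * L ^ (N - j) + 1) ^ d := card_filter_supNorm_le_le _
      _ ≤ (3 * L ^ (N - j)) ^ d := by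
          refine Nat.pow_le_pow_left ?_ d
          have : 1 ≤ L ^ (N - j) := Nat.one_le_pow _ _ (by omega)
          omega
      _ = 3 ^ d * L ^ ((N - j) * d) := by rw [mul_pow, ← pow_mul]

/-! ## The Hilbert–Schmidt sum over shells -/

/-- **Sum over modes ≤ sum over shells**: if `ρ(0) = 0` and every nonzero mode lies in some shell
`j` with `|ρ(κ)| ≤ g(j)`, then on `(ℤ/L^N)^d` (`L ≥ 5`)
`Σ_κ ρ(κ)² ≤ Σ_{j ≤ N} 3^d L^{(N−j)d} g(j)²`. [cite: Buchholz2016, Thm 4.5 (proof, (4.37))] -/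
theorem sum_sq_le_sum_shells {L N : ℕ} (hL : 5 ≤ L) (hM : M = L ^ N) {ρ : (Fin d → ZMod M) → ℝ}
    {g : ℕ → ℝ} (hρ0 : ρ 0 = 0)
    (hρ : ∀ κ, κ ≠ 0 → ∃ j, InShell L j κ ∧ |ρ κ| ≤ g j) :
    ∑ κ, ρ κ ^ 2 ≤ ∑ j ∈ range (N + 1), (3 : ℝ) ^ d * (L : ℝ) ^ ((N - j) * d) * g j ^ 2 := by
  classical
  -- pointwise: `ρ(κ)² ≤ Σ_j 1[κ ≠ 0 ∧ κ ∈ 𝔸_j] g(j)²`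
  have hpt : ∀ κ : Fin d → ZMod M,
      ρ κ ^ 2 ≤ ∑ j ∈ range (N + 1), (if κ ≠ 0 ∧ InShell L j κ then g j ^ 2 else 0) := by
    intro κ
    by_cases hκ : κ = 0
    · rw [hκ, hρ0]
      simp only [ne_eq, not_true_eq_false, false_and, if_false, sum_const_zero]
      norm_num
    · obtain ⟨j, hj, hle⟩ := hρ κ hκ
      have hjN : j ≤ N := inShell_le hL hM hκ hj
      have hsq : ρ κ ^ 2 ≤ g j ^ 2 := by
        rw [← sq_abs (ρ κ)]
        exact pow_le_pow_left₀ (abs_nonneg _) hle 2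
      refine hsq.trans ?_
      rw [← sum_filter]
      refine single_le_sum (f := fun j => g j ^ 2) (fun _ _ => sq_nonneg _) ?_
      rw [mem_filter, mem_range]
      exact ⟨Nat.lt_succ_of_le hjN, hκ, hj⟩
  calc ∑ κ, ρ κ ^ 2
      ≤ ∑ κ, ∑ j ∈ range (N + 1), (if κ ≠ 0 ∧ InShell L j κ then g j ^ 2 else 0) :=
        sum_le_sum fun κ _ => hpt κ
    _ = ∑ j ∈ range (N + 1), ∑ κ, (if κ ≠ 0 ∧ InShell L j κ then g j ^ 2 else 0) := sum_comm
    _ = ∑ j ∈ range (N + 1),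
          ((univ.filter fun κ : Fin d → ZMod M => κ ≠ 0 ∧ InShell L j κ).card : ℝ) * g j ^ 2 := by
        refine sum_congr rfl fun j _ => ?_
        rw [← sum_filter, sum_const, nsmul_eq_mul]
    _ ≤ ∑ j ∈ range (N + 1), (3 : ℝ) ^ d * (L : ℝ) ^ ((N - j) * d) * g j ^ 2 := by
        refine sum_le_sum fun j _ => mul_le_mul_of_nonneg_right ?_ (sq_nonneg _)
        exact_mod_cast card_filter_inShell_le hL hM j

/-- **One shell term**: for `L ≥ 2`, `d ≥ 1`, `d + 1 ≤ 2(ñ−n)`, `j ≤ N`: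
`L^{(N−j)d}/(L^{(k−j)(ñ−n)})² ≤ L^{(N−k)d} · (L^{−1})^{k−j} · (L^{−1})^{j−k}` (natural subtractions;
one of the two geometric factors is `1`). [cite: Buchholz2016, Thm 4.5 (proof, (4.37))] -/
theorem pow_div_shell_sq_le {L : ℝ} (hL : 1 ≤ L) {d n ñ N k j : ℕ} (hd : 1 ≤ d) (hgap : d + 1 ≤ 2 * (ñ - n))
    (hjN : j ≤ N) :
    L ^ ((N - j) * d) / (L ^ ((k - j) * (ñ - n))) ^ 2 ≤
      L ^ ((N - k) * d) * (L⁻¹) ^ (k - j) * (L⁻¹) ^ (j - k) := by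
  have hL0 : 0 < L := by linarith
  rw [← pow_mul, inv_pow, inv_pow, div_le_iff₀ (by positivity)]
  -- clear the inverses: multiply by `L^{k-j} L^{j-k}`
  rw [show L ^ ((N - k) * d) * (L ^ (k - j))⁻¹ * (L ^ (j - k))⁻¹ * L ^ ((k - j) * (ñ - n) * 2)
      = L ^ ((N - k) * d + (k - j) * (ñ - n) * 2) / (L ^ (k - j) * L ^ (j - k)) by
    rw [pow_add]; field_simp]
  rw [le_div_iff₀ (by positivity), ← pow_add, ← pow_add]
  refine pow_le_pow_right₀ hL ?_
  -- the exponent inequality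
  rcases le_or_gt j k with hjk | hkj
  · rw [Nat.sub_eq_zero_of_le hjk, add_zero]
    obtain ⟨a, rfl⟩ := Nat.exists_eq_add_of_le hjk
    rw [Nat.add_sub_cancel_left]
    rcases le_or_gt (j + a) N with hkN | hNk
    · obtain ⟨b, rfl⟩ := Nat.exists_eq_add_of_le hkN
      rw [Nat.add_sub_cancel_left, show j + a + b - j = a + b by omega]
      nlinarith [Nat.mul_le_mul_left a hgap]
    · rw [Nat.sub_eq_zero_of_le hNk.le, zero_mul, zero_add]
      obtain ⟨c, rfl⟩ := Nat.exists_eq_add_of_le hjN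
      rw [Nat.add_sub_cancel_left]
      have hca : c ≤ a := by omega
      nlinarith [Nat.mul_le_mul_left a hgap, Nat.mul_le_mul_right d hca]
  · rw [Nat.sub_eq_zero_of_le hkj.le, zero_mul, zero_mul, add_zero, zero_add]
    obtain ⟨u, rfl⟩ := Nat.exists_eq_add_of_le hkj.le
    obtain ⟨v, rfl⟩ := Nat.exists_eq_add_of_le hjN
    rw [Nat.add_sub_cancel_left, Nat.add_sub_cancel_left, show k + u + v - k = u + v by omega]
    nlinarith [Nat.le_mul_of_pos_right u hd]

/-- **The geometric sum over shells** ([Buc16], end of the proof of Thm 4.5): for `L ≥ 2`, `d ≥ 1`,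
`d + 1 ≤ 2(ñ−n)`: `Σ_{j ≤ N} L^{(N−j)d}/(L^{(k−j)(ñ−n)})² ≤ 3 · L^{(N−k)d}`.
[cite: Buchholz2016, Thm 4.5 (proof, (4.37))] -/
theorem sum_shells_geom_le {L : ℝ} (hL : 2 ≤ L) {d n ñ : ℕ} (hd : 1 ≤ d) (hgap : d + 1 ≤ 2 * (ñ - n))
    (N k : ℕ) :
    ∑ j ∈ range (N + 1), L ^ ((N - j) * d) / (L ^ ((k - j) * (ñ - n))) ^ 2 ≤ 3 * L ^ ((N - k) * d) := by
  have hL1 : 1 ≤ L := by linarith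
  have hL0 : 0 < L := by linarith
  have hq0 : 0 ≤ L⁻¹ := by positivity
  have hq : L⁻¹ ≤ 1 / 2 := by rw [one_div]; exact inv_anti₀ two_pos hL
  have hq1 : L⁻¹ < 1 := by linarith
  -- geometric series bounds
  have hgeom : ∀ s : Finset ℕ, ∑ i ∈ s, (L⁻¹) ^ i ≤ 2 := fun s =>
    calc ∑ i ∈ s, (L⁻¹) ^ i ≤ ∑' i, (L⁻¹) ^ i :=
          (summable_geometric_of_lt_one hq0 hq1).sum_le_tsum s (fun i _ => by positivity)
      _ = (1 - L⁻¹)⁻¹ := tsum_geometric_of_lt_one hq0 hq1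
      _ ≤ 2 := by
          rw [inv_le_comm₀ (by linarith) two_pos]; linarith
  have hgeom1 : ∀ s : Finset ℕ, (∀ i ∈ s, 1 ≤ i) → ∑ i ∈ s, (L⁻¹) ^ i ≤ 1 := by
    intro s hs
    calc ∑ i ∈ s, (L⁻¹) ^ i ≤ ∑ i ∈ s, (1 / 2) * (L⁻¹) ^ (i - 1) := by
          refine sum_le_sum fun i hi => ?_
          have : (L⁻¹) ^ i = L⁻¹ * (L⁻¹) ^ (i - 1) := by
            rw [← pow_succ', Nat.sub_add_cancel (hs i hi)]
          rw [this]
          exact mul_le_mul_of_nonneg_right hq (by positivity)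
      _ = (1 / 2) * ∑ i ∈ s, (L⁻¹) ^ (i - 1) := by rw [mul_sum]
      _ ≤ (1 / 2) * 2 := by
          refine mul_le_mul_of_nonneg_left ?_ (by norm_num)
          calc ∑ i ∈ s, (L⁻¹) ^ (i - 1) = ∑ i ∈ s.image (fun i => i - 1), (L⁻¹) ^ i := by
                rw [sum_image]
                intro a ha b hb h
                have := hs a ha; have := hs b hb; simp only at h; omega
            _ ≤ 2 := hgeom _
      _ = 1 := by norm_num
  -- termwise bound and split at `j ≤ k`
  calc ∑ j ∈ range (N + 1), L ^ ((N - j) * d) / (L ^ ((k - j) * (ñ - n))) ^ 2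
      ≤ ∑ j ∈ range (N + 1), L ^ ((N - k) * d) * (L⁻¹) ^ (k - j) * (L⁻¹) ^ (j - k) :=
        sum_le_sum fun j hj => pow_div_shell_sq_le hL1 hd hgap (Nat.lt_succ_iff.1 (mem_range.1 hj))
    _ = L ^ ((N - k) * d) * ∑ j ∈ range (N + 1), (L⁻¹) ^ (k - j) * (L⁻¹) ^ (j - k) := by
        rw [mul_sum]; exact sum_congr rfl fun j _ => by ring
    _ ≤ L ^ ((N - k) * d) * 3 := by
        refine mul_le_mul_of_nonneg_left ?_ (by positivity)
        rw [← sum_filter_add_sum_filter_not (range (N + 1)) (fun j => j ≤ k)]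
        have hA : ∑ j ∈ (range (N + 1)).filter (fun j => j ≤ k), (L⁻¹) ^ (k - j) * (L⁻¹) ^ (j - k) ≤ 2 := by
          calc ∑ j ∈ (range (N + 1)).filter (fun j => j ≤ k), (L⁻¹) ^ (k - j) * (L⁻¹) ^ (j - k)
              = ∑ j ∈ (range (N + 1)).filter (fun j => j ≤ k), (L⁻¹) ^ (k - j) := by
                refine sum_congr rfl fun j hj => ?_
                rw [(mem_filter.1 hj).2 |> Nat.sub_eq_zero_of_le, pow_zero, mul_one]
            _ = ∑ i ∈ ((range (N + 1)).filter (fun j => j ≤ k)).image (fun j => k - j), (L⁻¹) ^ i := by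
                rw [sum_image]
                intro a ha b hb h
                have := (mem_filter.1 ha).2; have := (mem_filter.1 hb).2; simp only at h; omega
            _ ≤ 2 := hgeom _
        have hB : ∑ j ∈ (range (N + 1)).filter (fun j => ¬ j ≤ k), (L⁻¹) ^ (k - j) * (L⁻¹) ^ (j - k) ≤ 1 := by
          calc ∑ j ∈ (range (N + 1)).filter (fun j => ¬ j ≤ k), (L⁻¹) ^ (k - j) * (L⁻¹) ^ (j - k)
              = ∑ j ∈ (range (N + 1)).filter (fun j => ¬ j ≤ k), (L⁻¹) ^ (j - k) := by
                refine sum_congr rfl fun j hj => ?_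
                have : k ≤ j := by have := (mem_filter.1 hj).2; omega
                rw [Nat.sub_eq_zero_of_le this, pow_zero, one_mul]
            _ = ∑ i ∈ ((range (N + 1)).filter (fun j => ¬ j ≤ k)).image (fun j => j - k), (L⁻¹) ^ i := by
                rw [sum_image]
                intro a ha b hb h
                have := (mem_filter.1 ha).2; have := (mem_filter.1 hb).2; simp only at h; omega
            _ ≤ 1 := by
                refine hgeom1 _ fun i hi => ?_
                obtain ⟨j, hj, rfl⟩ := mem_image.1 hi
                have := (mem_filter.1 hj).2; omega
        linarith
    _ = 3 * L ^ ((N - k) * d) := by ring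

/-- **The Hilbert–Schmidt bound of the shell-wise relative change** ([Buc16] (4.36)–(4.37)): on
`(ℤ/L^N)^d` (`L ≥ 5`, `d ≥ 1`, regularity gap `d + 1 ≤ 2(ñ−n)`), if `ρ(0) = 0` and every nonzero mode
lies in a shell `j` with `|ρ(κ)| ≤ E · K / L^{(k−j)(ñ−n)}`, then
`Σ_κ ρ(κ)² ≤ 3^{d+1} (E K)² · L^{(N−k)d}`. [cite: Buchholz2016, Thm 4.5 (proof, (4.36)–(4.37))] -/
theorem sum_sq_le_of_shellRatio {L N : ℕ} (hL : 5 ≤ L) (hM : M = L ^ N) {n ñ k : ℕ}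
    (hd : 1 ≤ d) (hgap : d + 1 ≤ 2 * (ñ - n)) {E K : ℝ}
    {ρ : (Fin d → ZMod M) → ℝ} (hρ0 : ρ 0 = 0)
    (hρ : ∀ κ, κ ≠ 0 → ∃ j, InShell L j κ ∧ |ρ κ| ≤ E * (K / (L : ℝ) ^ ((k - j) * (ñ - n)))) :
    ∑ κ, ρ κ ^ 2 ≤ (3 : ℝ) ^ (d + 1) * (E * K) ^ 2 * (L : ℝ) ^ ((N - k) * d) := by
  have hLr : (2 : ℝ) ≤ (L : ℝ) := by exact_mod_cast (show 2 ≤ L by omega)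
  have hL0 : (0 : ℝ) < (L : ℝ) := by linarith
  have h1 := sum_sq_le_sum_shells hL hM hρ0 hρ
  refine h1.trans ?_
  have hrw : ∀ j, (3 : ℝ) ^ d * (L : ℝ) ^ ((N - j) * d) * (E * (K / (L : ℝ) ^ ((k - j) * (ñ - n)))) ^ 2
      = (3 : ℝ) ^ d * (E * K) ^ 2 * ((L : ℝ) ^ ((N - j) * d) / ((L : ℝ) ^ ((k - j) * (ñ - n))) ^ 2) := by
    intro j
    have : (0 : ℝ) < (L : ℝ) ^ ((k - j) * (ñ - n)) := by positivity
    field_simp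
  calc ∑ j ∈ range (N + 1), (3 : ℝ) ^ d * (L : ℝ) ^ ((N - j) * d) * (E * (K / (L : ℝ) ^ ((k - j) * (ñ - n)))) ^ 2
      = (3 : ℝ) ^ d * (E * K) ^ 2 *
          ∑ j ∈ range (N + 1), (L : ℝ) ^ ((N - j) * d) / ((L : ℝ) ^ ((k - j) * (ñ - n))) ^ 2 := by
        rw [mul_sum]; exact sum_congr rfl fun j _ => hrw j
    _ ≤ (3 : ℝ) ^ d * (E * K) ^ 2 * (3 * (L : ℝ) ^ ((N - k) * d)) :=
        mul_le_mul_of_nonneg_left (sum_shells_geom_le hLr hd hgap N k) (by positivity)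
    _ = (3 : ℝ) ^ (d + 1) * (E * K) ^ 2 * (L : ℝ) ^ ((N - k) * d) := by rw [pow_succ]; ring

end Literature.MathematicalPhysics.StatisticalMechanics.GradientRG

end
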